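import Literature.Probability.Percolation.TrackExchangeSweep
import Literature.Probability.Percolation.StarTriangleWalks
import HarnessLib

/-!
# Track exchange in a strip: transport of an open walk through one sweep `Σ_j`

Grimmett–Manolescu, *Bond percolation on isoradial graphs* (PTRF 159 (2014) 273–327 =
arXiv:1204.0505), §5.3 (Figure 5.5: "the image path contains the black vertices and, in
addition, possibly some of the blue ones") and §6.2 (proofs of Lemmas 6.5–6.6): an open path
`γ` is carried along by the track exchange `Σ_j`, and the only way in which it can acquire new
vertices is recorded column by column — "for each primal vertex `v_{n,j}` [at the level `j`
being swept] the heights in columns `n+1` and `n+2` increase to `j+1` and `j`", the increase to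
`j+1` in column `n+1` happening "only if the secondary outcome occurs" at the star → triangle
move at `O_n`.

This file makes this precise and proves it, pathwise and for every value of the randomness, for
the sweep `ExchangeData.sweep` of `Literature.Probability.Percolation.TrackExchangeSweep` acting
jointly on the configuration and on a walk (`ExchangeData.sweepW`, built from the walk surgery
`subdivide`/`contract` of `StarTriangleWalks`):

* `TrackExchange.Clean q ω` — only coordinates of positive weight are present (an a.s. property
  of `P_q`, propagated surely by every step: `Clean.insertStep`, `Clean.sStep`, `Clean.tStep`,
  `Clean.removeStep`).
* `ExchangeData.Generated W₀ u z` — the three ways a label `z = (m, y)` not on the original walk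
  `W₀` can lie on the transported walk: `y = j` with `(m-2, j) ∈ W₀` (the new middle vertex
  `N_m`, reached through the travelling edge), `y = j-1` with `(m-1, j) ∈ W₀` (detour through
  `B_m`), or `y = j+1` with `(m-1, j) ∈ W₀` **and** the detour event `DetourAt u (m-1)`: the
  uniform variable driving the star → triangle move at `O_{m-1}` fell below the conditional
  probability `detourWeight (m-1)` of the distinguished outcome (GM14's "secondary outcome",
  of probability `η_k(n) = p_{π-A}p_{π-B}/(p_A p_B)`).
* **`ExchangeData.sweepW_spec`** — if `ω` is clean for `P_{α,β}` on the strip and `W₀` is an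
  `ω`-open walk avoiding `⋆`, with endpoints off the middle row, avoiding the boundary columns
  `-M, M-1, M`, then after the sweep: the configuration is clean for `P_{α,σ_jβ}`, the
  transported walk is open, has the same endpoints, avoids `⋆`, and each of its vertices is a
  vertex of `W₀` or `Generated` from one.

The proof runs the invariant `SlideInv` through the `2M` moves (`RandomMapChain.run_invariant`):
at stage `i₀`, besides cleanliness/openness/endpoints, (odd) `⋆ ∉ W` and a traversal of the
travelling edge `B_{i₀}T_{i₀}` witnesses `(i₀-1, j) ∈ W₀`; (even) `⋆ ∈ W` witnesses
`(i₀, j) ∈ W₀`; middle labels to the right of `i₀` are original; provenance as above.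

## References

* G. R. Grimmett, I. Manolescu, PTRF 159 (2014) 273–327, arXiv:1204.0505, §5.3 (Fig. 5.5),
  §6.2 (proofs of Lemmas 6.5, 6.6).
-/

noncomputable section

namespace Literature.Probability.Percolation

open LatticeModels StarTriangle Real MeasureTheory

/-! ### A fold invariant for `RandomMapChain.run` -/

namespace RandomMapChain

/-- **Invariants along a chain**: a property of (step count, state) preserved by every step
holds at the end. [folklore] -/
theorem run_invariant {A : Type*} : ∀ (n : ℕ) (f : Fin n → A → unitInterval → A) (a : A)
    (u : Fin n → unitInterval) (P : ℕ → A → Prop), P 0 a →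
    (∀ (k : Fin n) (b : A), P k b → P (k + 1) (f k b (u k))) → P n (run n f a u)
  | 0, _, _, _, _, h0, _ => h0
  | n + 1, f, a, u, P, h0, hstep => by
    rw [run_succ]
    refine run_invariant n (fun k => f k.succ) (f 0 a (u 0)) (fun k => u k.succ) (fun k => P (k + 1))
      (hstep 0 a h0) fun k b hb => ?_
    have := hstep k.succ b hb
    simpa using this

/-- The first component of a chain on pairs whose first component evolves autonomously.
[folklore] -/
theorem fst_run {A B : Type*} : ∀ (n : ℕ) (f : Fin n → A × B → unitInterval → A × B)
    (g : Fin n → A → unitInterval → A), (∀ k x u, (f k x u).1 = g k x.1 u) →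
    ∀ (x : A × B) (u : Fin n → unitInterval), (run n f x u).1 = run n g x.1 u
  | 0, _, _, _, _, _ => rfl
  | n + 1, f, g, h, x, u => by
    rw [run_succ, run_succ, fst_run n (fun k => f k.succ) (fun k => g k.succ) (fun k => h k.succ), h]

end RandomMapChain

namespace TrackExchange

/-! ### Clean configurations -/

/-- A configuration is **clean** for the weights `q` if it contains only coordinates of positive
weight (`P_q`-almost every configuration is clean). [folklore] -/
def Clean (q : Sym2 SV → unitInterval) (ω : Set (Sym2 SV)) : Prop := ∀ e ∈ ω, 0 < (q e : ℝ)

/-- A coordinate of weight zero is absent from a clean configuration. [folklore] -/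
theorem Clean.not_mem {q : Sym2 SV → unitInterval} {ω : Set (Sym2 SV)} (h : Clean q ω) {e : Sym2 SV}
    (he : q e = 0) : e ∉ ω := fun h' => by
  have := h e h'
  rw [he] at this
  exact lt_irrefl _ this

namespace ExchangeData

variable {D : ExchangeData}

/-- At an odd stage `⋆` is isolated in a clean configuration. [cite: GrimmettManolescu2014Isoradial, §5.3] -/
theorem Clean.none_not_mem_of_odd {i₀ : ℤ} {ω : Set (Sym2 SV)} (h : Clean (D.oddStage i₀) ω) :
    ∀ e ∈ ω, none ∉ e := fun _ he hn =>
  h.not_mem (oddStage_eq_zero_of_mem_none i₀ hn) he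

/-- At an even stage the triangle of the next move is absent from a clean configuration.
[cite: GrimmettManolescu2014Isoradial, §5.3] -/
theorem Clean.triEdge_not_mem_of_even (hV : D.Valid) {i₀ : ℤ} (hpar : Even (i₀ + D.j)) (hi : -(D.M : ℤ) ≤ i₀)
    (hi' : i₀ < D.M) {ω : Set (Sym2 SV)} (h : Clean (D.evenStage i₀) ω) (k : Fin 3) :
    triEdge (D.evenTri i₀) k ∉ ω := by
  refine h.not_mem ?_
  rw [evenStage_eq_afterMove hpar hi hi' hV.lu (hV.lo i₀ hi hi') (hV.up i₀ hi hi')]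
  exact afterMove_triEdge _ _ _ k

/-- At an even stage the only pairs at `⋆` of positive weight are the three star edges.
[cite: GrimmettManolescu2014Isoradial, §5.3] -/
theorem evenStage_none_pos_imp (i₀ : ℤ) {z : SV} (h : 0 < (D.evenStage i₀ s(none, z) : ℝ)) :
    z = D.mid i₀ ∨ z = D.bot (i₀ + 1) ∨ z = D.top (i₀ + 1) := by
  by_contra hz
  push Not at hz
  rw [evenStage_apply] at h
  rw [if_neg (fun h' => hz.2.2 (Sym2.congr_right.1 h')), if_neg (fun h' => hz.2.1 (Sym2.congr_right.1 h')),
    if_neg (fun h' => hz.1 (Sym2.congr_right.1 h')),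
    if_neg (fun h' => by have := (Sym2.ext_iff.1 h') none; simp [ExchangeData.mid, ExchangeData.top] at this),
    if_neg (fun h' => by have := (Sym2.ext_iff.1 h') none; simp [ExchangeData.mid, ExchangeData.bot] at this),
    canonicalWeight_eq_zero_of_mem_none _ _ (Sym2.mem_mk_left _ _)] at h
  exact lt_irrefl _ h

/-- At an even stage the edges of a clean configuration at `⋆` are star edges.
[cite: GrimmettManolescu2014Isoradial, §5.3] -/
theorem Clean.eq_starEdge_of_even {i₀ : ℤ} {ω : Set (Sym2 SV)} (h : Clean (D.evenStage i₀) ω) :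
    ∀ e ∈ ω, none ∈ e → ∃ k, e = starEdge (D.evenTri i₀) none k := by
  intro e he hn
  obtain ⟨z, rfl⟩ := Sym2.mem_iff_exists.1 hn
  rcases evenStage_none_pos_imp i₀ (h _ he) with rfl | rfl | rfl
  · exact ⟨0, rfl⟩
  · exact ⟨1, rfl⟩
  · exact ⟨2, rfl⟩

/-- **The even-stage move keeps configurations clean.** [cite: GrimmettManolescu2014Isoradial, §5.3] -/
theorem Clean.sStep (hV : D.Valid) {i₀ : ℤ} (hpar : Even (i₀ + D.j)) (hi : -(D.M : ℤ) ≤ i₀) (hi' : i₀ < D.M)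
    {ω : Set (Sym2 SV)} (h : Clean (D.evenStage i₀) ω) (u : unitInterval) :
    Clean (D.oddStage (i₀ + 1)) (D.sStep i₀ ω u) := by
  intro e he
  unfold ExchangeData.sStep sMove at he
  rcases (mem_overlay_iff _ _ _).1 he with ⟨heω, hrange⟩ | ⟨k, -, rfl⟩
  · have hT : ∀ k, e ≠ triEdge (D.evenTri i₀) k := fun k hk => Clean.triEdge_not_mem_of_even hV hpar hi hi' h k (hk ▸ heω)
    have hS : ∀ k, e ≠ starEdge (D.evenTri i₀) none k := fun k hk => hrange ⟨k, hk.symm⟩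
    have h1 := h e heω
    rwa [evenStage_eq_afterMove hpar hi hi' hV.lu (hV.lo i₀ hi hi') (hV.up i₀ hi hi'), afterMove_of_ne _ hT hS] at h1
  · exact oddStage_succ_triEdge_pos hV hi hi' hpar k

/-- `sym2Equiv σ` acts as `Sym2.map σ`. [folklore] -/
theorem coe_sym2Equiv (σ : SV ≃ SV) : (⇑(sym2Equiv σ) : Sym2 SV → Sym2 SV) = Sym2.map σ :=
  funext (sym2Equiv_apply σ)

/-- **The odd-stage move keeps configurations clean.** [cite: GrimmettManolescu2014Isoradial, §5.3] -/
theorem Clean.tStep (hV : D.Valid) {i₀ : ℤ} (hpar : ¬ Even (i₀ + D.j)) (hi : -(D.M : ℤ) ≤ i₀) (hi' : i₀ < D.M)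
    {ω : Set (Sym2 SV)} (h : Clean (D.oddStage i₀) ω) (u : unitInterval) :
    Clean (D.evenStage (i₀ + 1)) (D.tStep i₀ ω u) := by
  intro e he
  unfold ExchangeData.tStep at he
  rw [Set.mem_image] at he
  obtain ⟨e', he', rfl⟩ := he
  rw [sym2Equiv_apply, ← afterMove_oddStage hpar hi hi' hV.lu (hV.lo i₀ hi hi') (hV.up i₀ hi hi') e']
  unfold tMove at he'
  rcases (mem_overlay_iff _ _ _).1 he' with ⟨heω, hrange⟩ | ⟨k, -, rfl⟩
  · have hS : ∀ k, e' ≠ starEdge (D.oddTri i₀) none k := fun k hk =>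
      Clean.none_not_mem_of_odd h e' heω (hk ▸ Sym2.mem_mk_left _ _)
    have hT : ∀ k, e' ≠ triEdge (D.oddTri i₀) k := fun k hk => hrange ⟨k, hk.symm⟩
    rw [afterMove_of_ne _ hT hS]
    exact h e' heω
  · rw [coe_afterMove_starEdge (oddTri_injective i₀) (oddTri_ne_none i₀)]
    linarith [oddStage_triEdge_lt_one hpar hi hi' hV.lu (hV.lo i₀ hi hi') (hV.up i₀ hi hi') k]

/-- **Every move keeps configurations clean.** [cite: GrimmettManolescu2014Isoradial, §5.3] -/
theorem Clean.moveStep (hV : D.Valid) {i₀ : ℤ} (hi : -(D.M : ℤ) ≤ i₀) (hi' : i₀ < D.M)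
    {ω : Set (Sym2 SV)} (h : Clean (D.stage i₀) ω) (u : unitInterval) :
    Clean (D.stage (i₀ + 1)) (D.moveStep i₀ ω u) := by
  unfold ExchangeData.stage ExchangeData.moveStep at *
  by_cases hpar : Even (i₀ + D.j)
  · have hpar' : ¬ Even (i₀ + 1 + D.j) := fun h' => (even_succ_add_iff i₀).1 h' hpar
    simp only [hpar, hpar', if_true, if_false] at h ⊢
    exact Clean.sStep hV hpar hi hi' h u
  · have hpar' : Even (i₀ + 1 + D.j) := (even_succ_add_iff i₀).2 hpar
    simp only [hpar, hpar', if_true, if_false] at h ⊢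
    exact Clean.tStep hV hpar hi hi' h u

/-- **Insertion keeps configurations clean.** [cite: GrimmettManolescu2014Isoradial, §5.3] -/
theorem Clean.insertStep (hV : D.Valid) {ω : Set (Sym2 SV)} (h : Clean D.initial ω) (u : unitInterval) :
    Clean (D.stage (-(D.M : ℤ))) (D.insertStep ω u) := by
  classical
  intro e he
  unfold ExchangeData.insertStep at he
  unfold ExchangeData.stage
  by_cases hpar : Even (-(D.M : ℤ) + D.j)
  · simp only [hpar, if_true] at he ⊢
    rw [evenStage_neg hpar, Function.update_apply]
    rcases (mem_resample_iff _ _ _ _ _).1 he with ⟨hne, hmem⟩ | ⟨rfl, hlt⟩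
    · rw [if_neg hne, Function.comp_apply]
      rw [Set.mem_image] at hmem
      obtain ⟨e', he', rfl⟩ := hmem
      rw [sym2Equiv_apply, sym2Map_swapMid_swapMid]
      exact h e' he'
    · rw [if_pos rfl]; exact coe_angleWeight_pos hV.lu
  · simp only [hpar, if_false] at he ⊢
    rw [oddStage_neg, Function.update_apply]
    rcases (mem_resample_iff _ _ _ _ _).1 he with ⟨hne, hmem⟩ | ⟨rfl, hlt⟩
    · rw [if_neg hne]; exact h e hmem
    · rw [if_pos rfl]
      exact coe_angleWeight_pos (θ := π - (D.up - D.lo)) ⟨by linarith [hV.lu.2], by linarith [hV.lu.1]⟩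

/-- **Removal keeps configurations clean.** [cite: GrimmettManolescu2014Isoradial, §5.3] -/
theorem Clean.removeStep {ω : Set (Sym2 SV)} (h : Clean (D.stage D.M) ω) : Clean D.exchanged (D.removeStep ω) := by
  intro e he
  unfold ExchangeData.removeStep at he
  unfold ExchangeData.stage at h
  by_cases hpar : Even ((D.M : ℤ) + D.j)
  · simp only [hpar, if_true] at he h
    obtain ⟨heω, hne⟩ := he
    rw [← update_evenStage_M, Function.update_of_ne (by simpa using hne)]
    exact h e heω
  · simp only [hpar, if_false] at he h
    obtain ⟨heω, hne⟩ := he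
    rw [← update_oddStage_M, Function.update_of_ne (by simpa using hne)]
    exact h e heω

/-! ### The sweep on (configuration, walk) pairs -/

/-- The state of the pathwise process: a configuration and a walk. [folklore] -/
abbrev WState : Type := Set (Sym2 SV) × List SV

variable (D)

/-- **Even-stage move with transport of the walk**: `S` at `⋆ = O_{i₀}`; the walk is contracted
through `⋆` according to the triangle laid down. [cite: GrimmettManolescu2014Isoradial, §5.3] -/
def sStepW (i₀ : ℤ) (x : WState) (u : unitInterval) : WState :=
  (D.sStep i₀ x.1 u, contract (D.evenTri i₀) none (readLocal (triEdge (D.evenTri i₀)) (D.sStep i₀ x.1 u)) x.2)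

/-- **Odd-stage move with transport of the walk**: `T` at `(B_{i₀}, O_{i₀+1}, T_{i₀})` with
subdivision of the traversed triangle edges through the new centre, then the relabelling
`⋆ ↔ (i₀+1, j)` of both. [cite: GrimmettManolescu2014Isoradial, §5.3] -/
def tStepW (i₀ : ℤ) (x : WState) (u : unitInterval) : WState :=
  (D.tStep i₀ x.1 u, (subdivide (D.oddTri i₀) none x.2).map (D.swapMid (i₀ + 1)))

/-- The move from stage `i₀` to stage `i₀ + 1` on pairs. [cite: GrimmettManolescu2014Isoradial, §5.3] -/
def moveStepW (i₀ : ℤ) (x : WState) (u : unitInterval) : WState :=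
  if Even (i₀ + D.j) then D.sStepW i₀ x u else D.tStepW i₀ x u

/-- Sliding, on pairs. [cite: GrimmettManolescu2014Isoradial, §5.3] -/
def slideW (x : WState) (u : Fin (2 * D.M) → unitInterval) : WState :=
  RandomMapChain.run (2 * D.M) (fun t => D.moveStepW (-(D.M : ℤ) + t)) x u

/-- **The sweep `Σ_j` acting on a configuration and a walk** (insertion and removal do not
touch the walk). [cite: GrimmettManolescu2014Isoradial, §5.3] -/
def sweepW (x : WState) (r : unitInterval × (Fin (2 * D.M) → unitInterval)) : WState :=
  (D.removeStep (D.slideW (D.insertStep x.1 r.1, x.2) r.2).1, (D.slideW (D.insertStep x.1 r.1, x.2) r.2).2)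

/-- The configuration component of the move on pairs is the move. [folklore] -/
theorem moveStepW_fst (i₀ : ℤ) (x : WState) (u : unitInterval) : (D.moveStepW i₀ x u).1 = D.moveStep i₀ x.1 u := by
  unfold moveStepW ExchangeData.moveStep sStepW tStepW
  split_ifs <;> rfl

/-- The configuration component of sliding on pairs is sliding. [folklore] -/
theorem slideW_fst (x : WState) (u : Fin (2 * D.M) → unitInterval) : (D.slideW x u).1 = D.slide x.1 u :=
  RandomMapChain.fst_run (2 * D.M) (fun t => D.moveStepW (-(D.M : ℤ) + t)) (fun t => D.moveStep (-(D.M : ℤ) + t))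
    (fun _ y v => D.moveStepW_fst _ y v) x u

/-- **The configuration component of the sweep on pairs is the sweep** (so its law is given by
`map_sweep`). [folklore] -/
theorem sweepW_fst (x : WState) (r : unitInterval × (Fin (2 * D.M) → unitInterval)) :
    (D.sweepW x r).1 = D.sweep x.1 r := by
  unfold sweepW ExchangeData.sweep
  rw [slideW_fst]

/-! ### The detour event and the provenance of new vertices -/

/-- The conditional probability of the distinguished ("secondary") outcome of the star →
triangle move at `O_{i₀}` given a full star: `odds(p_{B_{i₀+1}T_{i₀+1}}) · odds(p_{N_{i₀}T_{i₀+1}})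
= p_{π-A}p_{π-B}/(p_A p_B)`, `A = β_{j-1} - α_{i₀}`, `B = β_j - β_{j-1}` (`sWeight_full_ttf`).
[cite: GrimmettManolescu2014Isoradial, §6.2 (6.28)] -/
def detourWeight (i₀ : ℤ) : ℝ :=
  sWeight (triParam (D.oddStage (i₀ + 1)) (triEdge (D.evenTri i₀))) ![true, true, true] ![true, true, false]

/-- **The detour event at column `i₀`**: the uniform variable driving the star → triangle move
at `O_{i₀}` is below the conditional probability of the distinguished outcome (this dominates
GM14's `Y_n = 1`). [cite: GrimmettManolescu2014Isoradial, §6.2] -/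
def DetourAt (u : Fin (2 * D.M) → unitInterval) (i₀ : ℤ) : Prop :=
  ∃ t : Fin (2 * D.M), -(D.M : ℤ) + t = i₀ ∧ (u t : ℝ) < D.detourWeight i₀

/-- **How a new label arises during `Σ_j`** (GM14 Fig. 5.5, blue vertices): `(m, j)` through the
travelling edge from `(m-2, j)`; `(m, j-1)` as the lower detour from `(m-1, j)`; `(m, j+1)` as the
upper detour from `(m-1, j)`, which requires the detour event at column `m-1`.
[cite: GrimmettManolescu2014Isoradial, §6.2] -/
def Generated (W₀ : List SV) (u : Fin (2 * D.M) → unitInterval) (z : SV) : Prop :=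
  ∃ m y : ℤ, z = some (m, y) ∧
    ((y = D.j ∧ some (m - 2, D.j) ∈ W₀) ∨ (y = D.j - 1 ∧ some (m - 1, D.j) ∈ W₀) ∨
      (y = D.j + 1 ∧ some (m - 1, D.j) ∈ W₀ ∧ D.DetourAt u (m - 1)))

/-! ### The invariant of the slide -/

/-- The invariant at stage `i₀` of the slide, for the original walk `W₀` with endpoints `P₀, P₁`
and the noise `u`. [cite: GrimmettManolescu2014Isoradial, §6.2] -/
structure SlideInv (W₀ : List SV) (P₀ P₁ : SV) (u : Fin (2 * D.M) → unitInterval) (i₀ : ℤ) (x : WState) : Prop where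
  /-- only coordinates of positive weight are present -/
  clean : Clean (D.stage i₀) x.1
  /-- the walk is open -/
  walk : IsWalk x.1 x.2
  /-- first endpoint -/
  head : x.2.head? = some P₀
  /-- last endpoint -/
  last : x.2.getLast? = some P₁
  /-- at odd stages the walk avoids `⋆` -/
  none_odd : ¬ Even (i₀ + D.j) → none ∉ x.2
  /-- at even stages `⋆ = O_{i₀}` on the walk is an original vertex -/
  none_even : Even (i₀ + D.j) → none ∈ x.2 → some (i₀, D.j) ∈ W₀
  /-- at odd stages a traversal of the travelling edge comes from `O_{i₀-1}` -/
  xedge : ¬ Even (i₀ + D.j) → ∀ a b, [a, b] <:+: x.2 → s(a, b) = s(D.bot i₀, D.top i₀) → some (i₀ - 1, D.j) ∈ W₀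
  /-- middle labels to the right are original -/
  right : ∀ m : ℤ, i₀ < m → some (m, D.j) ∈ x.2 → some (m, D.j) ∈ W₀
  /-- provenance of every vertex -/
  prov : ∀ z ∈ x.2, z = none ∨ z ∈ W₀ ∨ D.Generated W₀ u z

variable {D}

/-- The two indices other than `2`. [folklore] -/
theorem eq_zero_one_of_thirdIdx_eq_two {ia ib : Fin 3} (hij : ia ≠ ib) (h : thirdIdx ia ib = 2) :
    (ia = 0 ∧ ib = 1) ∨ (ia = 1 ∧ ib = 0) := by
  revert hij h; fin_cases ia <;> fin_cases ib <;> decide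

/-- `σ = swapMid (i₀+1)` sends `w` to `⋆` iff `w` is the middle label. [folklore] -/
theorem swapMid_eq_none_iff (i : ℤ) (w : SV) : D.swapMid i w = none ↔ w = D.mid i := by
  unfold ExchangeData.swapMid
  rw [Equiv.swap_apply_eq_iff, Equiv.swap_apply_left]

/-- A walk in a clean even-stage configuration never stays at `⋆`. [folklore] -/
theorem not_infix_none_none {i₀ : ℤ} {x : WState} (hc : Clean (D.evenStage i₀) x.1) (hw : IsWalk x.1 x.2) :
    ¬ [none, none] <:+: x.2 := by
  intro h
  obtain ⟨k, hk⟩ := Clean.eq_starEdge_of_even hc _ (hw.mem_of_infix h) (Sym2.mem_mk_left _ _)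
  have h1 : D.evenTri i₀ k ∈ s((none : SV), none) := by rw [hk]; exact Sym2.mem_mk_right _ _
  rw [Sym2.mem_iff] at h1
  rcases h1 with h1 | h1 <;> exact evenTri_ne_none i₀ k h1

section Step

variable {W₀ : List SV} {P₀ P₁ : SV} {u : Fin (2 * D.M) → unitInterval}

/-- **The even-stage step preserves the invariant.** [cite: GrimmettManolescu2014Isoradial, §6.2] -/
theorem SlideInv.sStep (hV : D.Valid) (hP₀ : P₀ ≠ none) (hP₁ : P₁ ≠ none)
    {i₀ : ℤ} (hpar : Even (i₀ + D.j)) (hi : -(D.M : ℤ) ≤ i₀) (hi' : i₀ < D.M)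
    {x : WState} (h : D.SlideInv W₀ P₀ P₁ u i₀ x) (t : Fin (2 * D.M)) (ht : -(D.M : ℤ) + t = i₀) :
    D.SlideInv W₀ P₀ P₁ u (i₀ + 1) (D.sStepW i₀ x (u t)) := by
  have hpar' : ¬ Even (i₀ + 1 + D.j) := fun h' => (even_succ_add_iff i₀).1 h' hpar
  have hstage : D.stage i₀ = D.evenStage i₀ := by unfold ExchangeData.stage; rw [if_pos hpar]
  have hstage' : D.stage (i₀ + 1) = D.oddStage (i₀ + 1) := by unfold ExchangeData.stage; rw [if_neg hpar']
  have hc : Clean (D.evenStage i₀) x.1 := hstage ▸ h.clean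
  set v := D.evenTri i₀ with hv_def
  have hv : Function.Injective v := evenTri_injective i₀
  have hvO : ∀ k, v k ≠ none := evenTri_ne_none i₀
  have hT : ∀ k, triEdge v k ∉ x.1 := Clean.triEdge_not_mem_of_even hV hpar hi hi' hc
  have hOst : ∀ e ∈ x.1, none ∈ e → ∃ k, e = starEdge v none k := Clean.eq_starEdge_of_even hc
  have hhead : x.2.head? ≠ some none := by rw [h.head]; simpa using hP₀
  have hlast : x.2.getLast? ≠ some none := by rw [h.last]; simpa using hP₁
  have hOO := not_infix_none_none hc h.walk
  set ω' := D.sStep i₀ x.1 (u t) with hω'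
  set tt : Fin 3 → Bool := readLocal (triEdge v) ω' with htt
  have hW' : (D.sStepW i₀ x (u t)).2 = contract v none tt x.2 := rfl
  have hΩ' : (D.sStepW i₀ x (u t)).1 = ω' := rfl
  refine ⟨?_, ?_, ?_, ?_, ?_, ?_, ?_, ?_, ?_⟩
  · rw [hstage', hΩ']; exact Clean.sStep hV hpar hi hi' hc _
  · rw [hW', hΩ']; exact isWalk_contract hv hvO hT hOst (u t) x.2 h.walk hhead
  · rw [hW', head?_contract v none tt x.2 hhead, h.head]
  · rw [hW', getLast?_contract v none tt x.2 hlast, h.last]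
  · intro _; rw [hW']; exact not_mem_contract hvO tt x.2 hhead hlast hOO
  · intro h'; exact absurd h' hpar'
  · intro _ a b hab he
    rw [hW'] at hab
    rcases infix_pair_contract v none tt x.2 hhead hOO hab with hab | ⟨a', b', h3, -, -⟩
    · -- an old traversal of the travelling edge is impossible: its weight was zero
      have hmem := h.walk.mem_of_infix hab
      rw [he] at hmem
      exact absurd hmem (hT 0)
    · have hn : none ∈ x.2 := h3.subset (by simp)
      have := h.none_even hpar hn
      rwa [add_sub_cancel_right]
  · intro m hm hz
    rw [hW'] at hz
    rcases mem_contract v none tt x.2 hz with hz | ⟨a, b, -, -, -, hz⟩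
    · exact h.right m (by omega) hz
    · exfalso
      unfold third at hz
      generalize thirdIdx (cornerIdx v a) (cornerIdx v b) = k at hz
      fin_cases k <;>
        simp [hv_def, ExchangeData.evenTri, ExchangeData.mid, ExchangeData.bot, ExchangeData.top] at hz <;> omega
  · intro z hz
    rw [hW'] at hz
    rcases mem_contract v none tt x.2 hz with hz | ⟨a, b, h3, hab, htk, rfl⟩
    · exact h.prov z hz
    · -- a detour: `a ⋆ b` was a passage of the walk through `⋆ = O_{i₀}`
      have hn : none ∈ x.2 := h3.subset (by simp)
      have hW₀ : some (i₀, D.j) ∈ W₀ := h.none_even hpar hn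
      have i1 : [a, none] <:+: [a, none, b] := ⟨[], [b], by simp⟩
      have i2 : [none, b] <:+: [a, none, b] := ⟨[a], [], by simp⟩
      have h1 : s(a, none) ∈ x.1 := h.walk.mem_of_infix (i1.trans h3)
      have h2 : s(none, b) ∈ x.1 := h.walk.mem_of_infix (i2.trans h3)
      obtain ⟨ia, rfl⟩ := eq_corner_of_mem hvO hOst h1
      obtain ⟨ib, rfl⟩ := eq_corner_of_mem hvO hOst (by rw [Sym2.eq_swap]; exact h2)
      have hij : ia ≠ ib := fun h' => hab (congrArg v h')
      rw [cornerIdx_apply hv, cornerIdx_apply hv] at htk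
      unfold third
      rw [cornerIdx_apply hv, cornerIdx_apply hv]
      -- which corner is the third one?
      rcases hk : thirdIdx ia ib with ⟨k, hk'⟩
      have hk3 : k = 0 ∨ k = 1 ∨ k = 2 := by omega
      rcases hk3 with rfl | rfl | rfl
      · -- the new middle vertex `N_{i₀} = (i₀, j)`: an original label
        right; left
        show D.evenTri i₀ ⟨0, hk'⟩ ∈ W₀
        exact hW₀
      · -- the lower detour through `B_{i₀+1} = (i₀+1, j-1)`
        right; right
        refine ⟨i₀ + 1, D.j - 1, rfl, Or.inr (Or.inl ⟨rfl, by rwa [add_sub_cancel_right]⟩)⟩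
      · -- the upper detour through `T_{i₀+1} = (i₀+1, j+1)`: the distinguished outcome
        right; right
        refine ⟨i₀ + 1, D.j + 1, rfl, Or.inr (Or.inr ⟨rfl, by rwa [add_sub_cancel_right], ?_⟩)⟩
        rw [add_sub_cancel_right]
        refine ⟨t, ht, ?_⟩
        -- the star at `⋆` was full and `S` returned `(true, true, false)`
        have hk2 : thirdIdx ia ib = 2 := by rw [hk]; rfl
        rw [hk2] at htk
        set s' : Fin 3 → Bool := readLocal (starEdge v none) x.1 with hs'
        have hread : tt = sMap (triParam (D.oddStage (i₀ + 1)) (triEdge v)) s' (u t) :=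
          readLocal_sMove (triEdge_injective hv) hT (u t)
        have hcompat : Compatible tt s' := hread ▸ compatible_sMap _ _ _
        have hsa : s' ia = true := by
          simp only [hs', readLocal, starEdge, decide_eq_true_eq]; rw [Sym2.eq_swap]; exact h1
        have hsb : s' ib = true := by
          simp only [hs', readLocal, starEdge, decide_eq_true_eq]; exact h2
        have htri : TriConn tt ia ib := (hcompat ia ib).2 (Or.inr ⟨hsa, hsb⟩)
        have hab' : tt ia = true ∧ tt ib = true := by
          rcases htri with h' | h' | h'
          · exact absurd h' hij
          · have := h' 2 (hk2 ▸ thirdIdx_ne_left hij) (hk2 ▸ thirdIdx_ne_right hij)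
            rw [this] at htk; exact absurd htk (by decide)
          · exact h'
        have httf : tt = ![true, true, false] := by
          funext k
          rcases eq_zero_one_of_thirdIdx_eq_two hij hk2 with ⟨rfl, rfl⟩ | ⟨rfl, rfl⟩ <;>
            fin_cases k <;> simp [hab'.1, hab'.2, htk]
        rw [hread] at httf
        exact ((sMap_eq_ttf_iff s' (u t : ℝ)).1 httf).2

/-- **The odd-stage step preserves the invariant.** [cite: GrimmettManolescu2014Isoradial, §6.2] -/
theorem SlideInv.tStep (hV : D.Valid) (hP₀ : P₀ ≠ none) (hP₀' : ∀ i, P₀ ≠ D.mid i)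
    (hP₁ : P₁ ≠ none) (hP₁' : ∀ i, P₁ ≠ D.mid i)
    {i₀ : ℤ} (hpar : ¬ Even (i₀ + D.j)) (hi : -(D.M : ℤ) ≤ i₀) (hi' : i₀ < D.M)
    {x : WState} (h : D.SlideInv W₀ P₀ P₁ u i₀ x) (t : Fin (2 * D.M)) :
    D.SlideInv W₀ P₀ P₁ u (i₀ + 1) (D.tStepW i₀ x (u t)) := by
  have hpar' : Even (i₀ + 1 + D.j) := (even_succ_add_iff i₀).2 hpar
  have hstage : D.stage i₀ = D.oddStage i₀ := by unfold ExchangeData.stage; rw [if_neg hpar]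
  have hstage' : D.stage (i₀ + 1) = D.evenStage (i₀ + 1) := by unfold ExchangeData.stage; rw [if_pos hpar']
  have hc : Clean (D.oddStage i₀) x.1 := hstage ▸ h.clean
  set v := D.oddTri i₀ with hv_def
  set σ := D.swapMid (i₀ + 1) with hσ
  have hv : Function.Injective v := oddTri_injective i₀
  have hvO : ∀ k, v k ≠ none := oddTri_ne_none i₀
  have hO : ∀ e ∈ x.1, none ∉ e := Clean.none_not_mem_of_odd hc
  have hn : none ∉ x.2 := h.none_odd hpar
  have hW' : (D.tStepW i₀ x (u t)).2 = (subdivide v none x.2).map σ := rfl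
  have hΩ' : (D.tStepW i₀ x (u t)).1 = D.tStep i₀ x.1 (u t) := rfl
  have hσP₀ : σ P₀ = P₀ := swapMid_of_ne hP₀ (hP₀' _)
  have hσP₁ : σ P₁ = P₁ := swapMid_of_ne hP₁ (hP₁' _)
  -- the labels on the new walk
  have hmem : ∀ z, z ∈ (subdivide v none x.2).map σ → (z = D.mid (i₀ + 1)) ∨ (σ z ∈ x.2 ∧ σ z ≠ none) := by
    intro z hz
    rw [List.mem_map] at hz
    obtain ⟨w, hw, rfl⟩ := hz
    rcases mem_subdivide v none hw with hw | rfl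
    · right
      rw [show σ (σ w) = w from Equiv.swap_apply_self _ _ _]
      exact ⟨hw, fun h' => hn (h' ▸ hw)⟩
    · left; exact Equiv.swap_apply_left _ _
  refine ⟨?_, ?_, ?_, ?_, ?_, ?_, ?_, ?_, ?_⟩
  · rw [hstage', hΩ']; exact Clean.tStep hV hpar hi hi' hc _
  · rw [hW', hΩ']
    unfold ExchangeData.tStep
    rw [coe_sym2Equiv]
    exact isWalk_map σ (isWalk_subdivide hv hvO hO (u t) h.walk)
  · rw [hW', List.head?_map, head?_subdivide, h.head]; simp [hσP₀]
  · rw [hW', List.getLast?_map, getLast?_subdivide, h.last]; simp [hσP₁]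
  · intro h'; exact absurd hpar' h'
  · intro _ hz
    rw [hW', List.mem_map] at hz
    obtain ⟨w, hw, hwn⟩ := hz
    rw [swapMid_eq_none_iff] at hwn
    subst hwn
    rcases mem_subdivide v none hw with hw | hw
    · exact h.right (i₀ + 1) (by omega) hw
    · exact absurd hw (mid_ne_none _)
  · intro h'; exact absurd hpar' h'
  · intro m hm hz
    rw [hW'] at hz
    rcases hmem _ hz with hz | ⟨hz, -⟩
    · simp [ExchangeData.mid] at hz; omega
    · rw [swapMid_of_ne (by simp) (by simp [ExchangeData.mid]; omega)] at hz
      exact h.right m (by omega) hz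
  · intro z hz
    rw [hW'] at hz
    rw [List.mem_map] at hz
    obtain ⟨w, hw, rfl⟩ := hz
    rcases mem_subdivide v none hw with hw' | rfl
    · -- an old vertex, possibly renamed to `⋆`
      by_cases hwm : w = D.mid (i₀ + 1)
      · left; rw [hwm]; exact Equiv.swap_apply_right _ _
      · rw [swapMid_of_ne (fun h' => hn (h' ▸ hw')) hwm]
        exact h.prov w hw'
    · -- the new middle vertex `N_{i₀+1}`, labelled `(i₀+1, j)`
      rw [show σ none = D.mid (i₀ + 1) from Equiv.swap_apply_left _ _]
      obtain ⟨a, b, hab, hc'⟩ := exists_pair_of_mem_subdivide v none hn hw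
      obtain ⟨hne, ⟨ia, rfl⟩, ⟨ib, rfl⟩⟩ := hc'
      have hij : ia ≠ ib := fun h' => hne (congrArg v h')
      -- either the pair touches `O_{i₀+1}` (an original label) or it is the travelling edge
      by_cases hmid : ia = 1 ∨ ib = 1
      · right; left
        have hm : D.mid (i₀ + 1) ∈ x.2 := by
          rcases hmid with rfl | rfl
          · exact hab.subset (by simp [hv_def, ExchangeData.oddTri])
          · exact hab.subset (by simp [hv_def, ExchangeData.oddTri])
        exact h.right (i₀ + 1) (by omega) hm
      · push Not at hmid
        have hX : s(v ia, v ib) = s(D.bot i₀, D.top i₀) := by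
          have h02 : (ia = 0 ∧ ib = 2) ∨ (ia = 2 ∧ ib = 0) := by
            revert hij hmid; fin_cases ia <;> fin_cases ib <;> decide
          rcases h02 with ⟨rfl, rfl⟩ | ⟨rfl, rfl⟩
          · rfl
          · exact Sym2.eq_swap
        have hW₀ := h.xedge hpar _ _ hab hX
        right; right
        exact ⟨i₀ + 1, D.j, rfl, Or.inl ⟨rfl, by rwa [show i₀ + 1 - 2 = i₀ - 1 by ring]⟩⟩

/-- **Every move preserves the invariant.** [cite: GrimmettManolescu2014Isoradial, §6.2] -/
theorem SlideInv.moveStep (hV : D.Valid) (hP₀ : P₀ ≠ none) (hP₀' : ∀ i, P₀ ≠ D.mid i)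
    (hP₁ : P₁ ≠ none) (hP₁' : ∀ i, P₁ ≠ D.mid i) {i₀ : ℤ} (hi : -(D.M : ℤ) ≤ i₀) (hi' : i₀ < D.M) {x : WState}
    (h : D.SlideInv W₀ P₀ P₁ u i₀ x) (t : Fin (2 * D.M)) (ht : -(D.M : ℤ) + t = i₀) :
    D.SlideInv W₀ P₀ P₁ u (i₀ + 1) (D.moveStepW i₀ x (u t)) := by
  unfold moveStepW
  split_ifs with hpar
  · exact h.sStep hV hP₀ hP₁ hpar hi hi' t ht
  · exact h.tStep hV hP₀ hP₀' hP₁ hP₁' hpar hi hi' t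

/-- **The invariant holds after sliding.** [cite: GrimmettManolescu2014Isoradial, §6.2] -/
theorem SlideInv.slideW (hV : D.Valid) (hP₀ : P₀ ≠ none) (hP₀' : ∀ i, P₀ ≠ D.mid i)
    (hP₁ : P₁ ≠ none) (hP₁' : ∀ i, P₁ ≠ D.mid i) {x : WState} (h : D.SlideInv W₀ P₀ P₁ u (-(D.M : ℤ)) x) :
    D.SlideInv W₀ P₀ P₁ u D.M (D.slideW x u) := by
  have key := RandomMapChain.run_invariant (2 * D.M) (fun t => D.moveStepW (-(D.M : ℤ) + t)) x u
    (fun n y => D.SlideInv W₀ P₀ P₁ u (-(D.M : ℤ) + n) y) (by simpa using h) fun k b hb => ?_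
  · have h2 : (-(D.M : ℤ) + 2 * (D.M : ℤ)) = D.M := by ring
    simp only [Nat.cast_mul, Nat.cast_ofNat, h2] at key
    exact key
  · have := hb.moveStep hV hP₀ hP₀' hP₁ hP₁' (by omega) (by have := k.2; omega) k rfl
    push_cast at this ⊢
    rw [add_assoc] at this
    exact this

end Step

/-! ### Insertion, removal, and the sweep -/

section Sweep

/-- **The invariant holds after insertion** when the walk avoids `⋆` and the left boundary
column. [cite: GrimmettManolescu2014Isoradial, §6.2] -/
theorem SlideInv.insert (hV : D.Valid) {W₀ : List SV} {P₀ P₁ : SV} {ω : Set (Sym2 SV)} (hC : Clean D.initial ω) (hW : IsWalk ω W₀)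
    (hh : W₀.head? = some P₀) (hl : W₀.getLast? = some P₁) (hn : none ∉ W₀)
    (hcol : ∀ m y, some (m, y) ∈ W₀ → -(D.M : ℤ) < m) (u : Fin (2 * D.M) → unitInterval) (u₀ : unitInterval) :
    D.SlideInv W₀ P₀ P₁ u (-(D.M : ℤ)) (D.insertStep ω u₀, W₀) := by
  classical
  have hlab : ∀ z ∈ W₀, ∃ m y, z = some (m, y) ∧ -(D.M : ℤ) < m := by
    intro z hz
    rcases z with _ | ⟨m, y⟩
    · exact absurd hz hn
    · exact ⟨m, y, rfl, hcol m y hz⟩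
  have hfix : ∀ z ∈ W₀, z ≠ none ∧ z ≠ D.mid (-(D.M : ℤ)) ∧ z ≠ D.bot (-(D.M : ℤ)) ∧ z ≠ D.top (-(D.M : ℤ)) := by
    intro z hz
    obtain ⟨m, y, rfl, hm⟩ := hlab z hz
    refine ⟨by simp, ?_, ?_, ?_⟩ <;>
      simp [ExchangeData.mid, ExchangeData.bot, ExchangeData.top] <;> omega
  -- the walk stays open: its edges are untouched by the insertion
  have hwalk : IsWalk (D.insertStep ω u₀) W₀ := by
    refine hW.of_forall_mem fun a b hab hmem => ?_
    have ha := hfix a (hab.subset (by simp))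
    have hb := hfix b (hab.subset (by simp))
    unfold ExchangeData.insertStep
    split_ifs with hpar
    · rw [mem_resample_iff]
      left
      refine ⟨fun h' => ?_, ?_⟩
      · have : (none : SV) ∈ s(a, b) := by rw [h']; exact Sym2.mem_mk_left _ _
        rw [Sym2.mem_iff] at this
        rcases this with h'' | h'' <;> [exact ha.1 h''.symm; exact hb.1 h''.symm]
      · refine ⟨s(a, b), hmem, ?_⟩
        rw [sym2Equiv_apply, Sym2.map_mk, swapMid_of_ne ha.1 ha.2.1, swapMid_of_ne hb.1 hb.2.1]
    · rw [mem_resample_iff]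
      left
      refine ⟨fun h' => ?_, hmem⟩
      have : D.bot (-(D.M : ℤ)) ∈ s(a, b) := by rw [h']; exact Sym2.mem_mk_left _ _
      rw [Sym2.mem_iff] at this
      rcases this with h'' | h'' <;> [exact ha.2.2.1 h''.symm; exact hb.2.2.1 h''.symm]
  refine ⟨Clean.insertStep hV hC u₀, hwalk, hh, hl, fun _ => hn, fun _ h' => absurd h' hn, ?_, fun _ _ h' => h', fun z hz => Or.inr (Or.inl hz)⟩
  intro _ a b hab he
  exfalso
  have ha := hfix a (hab.subset (by simp))
  have : D.bot (-(D.M : ℤ)) ∈ s(a, b) := by rw [he]; exact Sym2.mem_mk_left _ _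
  rw [Sym2.mem_iff] at this
  have hb := hfix b (hab.subset (by simp))
  rcases this with h'' | h'' <;> [exact ha.2.2.1 h''.symm; exact hb.2.2.1 h''.symm]

/-- **One sweep, pathwise** (GM14 §5.3, §6.2): clean in, clean out; the transported walk is
open with the same endpoints, avoids `⋆`, and every vertex of it is an original vertex or
`Generated` from one (the blue vertices of GM14 Fig. 5.5, with the detour event recorded).
Hypotheses: the endpoints are off the middle row and the walk avoids `⋆` and the boundary
columns `-M`, `M-1`, `M`. [cite: GrimmettManolescu2014Isoradial, §6.2] -/
theorem sweepW_spec (hV : D.Valid) {W₀ : List SV} {P₀ P₁ : SV} (hP₀ : P₀ ≠ none) (hP₀' : ∀ i, P₀ ≠ D.mid i)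
    (hP₁ : P₁ ≠ none) (hP₁' : ∀ i, P₁ ≠ D.mid i) {ω : Set (Sym2 SV)} (hC : Clean D.initial ω) (hW : IsWalk ω W₀)
    (hh : W₀.head? = some P₀) (hl : W₀.getLast? = some P₁) (hn : none ∉ W₀)
    (hcol : ∀ m y, some (m, y) ∈ W₀ → -(D.M : ℤ) < m ∧ m < (D.M : ℤ) - 1)
    (r : unitInterval × (Fin (2 * D.M) → unitInterval)) :
    Clean D.exchanged (D.sweepW (ω, W₀) r).1 ∧ IsWalk (D.sweepW (ω, W₀) r).1 (D.sweepW (ω, W₀) r).2 ∧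
      (D.sweepW (ω, W₀) r).2.head? = some P₀ ∧ (D.sweepW (ω, W₀) r).2.getLast? = some P₁ ∧
      none ∉ (D.sweepW (ω, W₀) r).2 ∧
      ∀ z ∈ (D.sweepW (ω, W₀) r).2, z ∈ W₀ ∨ D.Generated W₀ r.2 z := by
  have hins := SlideInv.insert hV hC hW hh hl hn (fun m y h => (hcol m y h).1) r.2 r.1
  have hM := hins.slideW hV hP₀ hP₀' hP₁ hP₁'
  set y := D.slideW (D.insertStep ω r.1, W₀) r.2 with hy
  have hfst : (D.sweepW (ω, W₀) r).1 = D.removeStep y.1 := rfl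
  have hsnd : (D.sweepW (ω, W₀) r).2 = y.2 := rfl
  rw [hfst, hsnd]
  -- no vertex of the original walk lies in the two rightmost columns
  have hMcol : some ((D.M : ℤ), D.j) ∉ W₀ := fun h => by have := (hcol _ _ h).2; omega
  have hMcol' : some ((D.M : ℤ) - 1, D.j) ∉ W₀ := fun h => by have := (hcol _ _ h).2; omega
  have hnone : none ∉ y.2 := by
    by_cases hpar : Even ((D.M : ℤ) + D.j)
    · exact fun h => hMcol (hM.none_even hpar h)
    · exact hM.none_odd hpar
  refine ⟨Clean.removeStep hM.clean, ?_, hM.head, hM.last, hnone, fun z hz => ?_⟩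
  · -- the removed edge is not used by the walk
    refine hM.walk.of_forall_mem fun a b hab hmem => ?_
    unfold ExchangeData.removeStep
    split_ifs with hpar
    · refine ⟨hmem, fun h' => ?_⟩
      have : (none : SV) ∈ s(a, b) := by rw [Set.mem_singleton_iff.1 h']; exact Sym2.mem_mk_left _ _
      rw [Sym2.mem_iff] at this
      rcases this with h'' | h''
      · exact hnone (h'' ▸ hab.subset (by simp))
      · exact hnone (h'' ▸ hab.subset (by simp))
    · refine ⟨hmem, fun h' => hMcol' ?_⟩
      exact hM.xedge hpar a b hab (Set.mem_singleton_iff.1 h')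
  · rcases hM.prov z hz with rfl | hz | hz
    · exact absurd hz hnone
    · exact Or.inl hz
    · exact Or.inr hz

end Sweep

end ExchangeData

end TrackExchange

end Literature.Probability.Percolation
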